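import Summits.CriticalPhenomena.PercolationContinuityZ3.Theorems.PercNearOneGluingNoHeavyLowerTailThreePointPivotalBHKPrelim
import HarnessLib

/-!
# The pivotality law `P(a|b|h) · P(h pivotal for a↔b) ≤ P(ah|b) · P(bh|a)` — every finite weighted graph

Support file for crux `stmt-CriticalPhenomena-4575` (`NoHeavyLowerTail`), seat `prim-l12-p1` gen 21
(`--supports stmt-CriticalPhenomena-4575`); sequel of `…ThreePointPivotalBHKPrelim` (walks, cells, conditioning).
Memo `run/shared/lean/prim/prim-l12/FROM-prim-l12-p1-g21-SEXTIC-ISOLATION-LAW.md` §3b.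

THEOREM `sep_mul_pivotal_le` [this work]: for bond percolation `prodBernoulli w` on a finite vertex type and distinct
`a b h`,  `P(a↮b, a↮h, b↮h) · P(a↔b ∧ a↮b off the star of h) ≤ P(a↔h, a↮b) · P(b↔h, a↮b)`  (`q·piv ≤ t·u`).
Here: the cell decomposition `real_cell_eq_sum` (each of the four cells is `Σ_x P(ω∖H=x)·1[a↮b in x]·α_±(x)·β_±(x)` with
the hitting probabilities `α, β` of the two off-star clusters), the law of the off-star configuration
(`real_singleton_star_closed`: it is the percolation `w₀` with the star of `h` closed), van den Berg–Häggström–Kahn 2006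
Thm. 1.4 for `w₀` applied to the increasing cluster functions `C ↦ P(hit of the vertex set of C)` (`sum_hit_bhk`), and the
final algebra `tu − q·piv = (ΣMια)(ΣMιβ) − (ΣMι)(ΣMιαβ) ≥ 0`.
-/

namespace Summit.CriticalPhenomena.PercolationContinuityZ3.Theorems.ThreePointPivotalBHK

open MeasureTheory Set
open Literature.Probability.Percolation Literature.Probability.LatticeModels
open scoped Classical

variable {V : Type*} [Fintype V] [DecidableEq V]

section Sums

variable (w : Sym2 V → unitInterval) (a b h : V)

/-- **The cell decomposition.**  For literals `P, Q`:  `P(a↮b off the star, (a↔h) ↔ P, (b↔h) ↔ Q) = Σ_x P(ω∖H = x)·1[a↮b in x]·α_P(x)·β_Q(x)`,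
where `α(x)` (`β(x)`) is the probability that an open pair at `h` meets the `x`-cluster of `a` (of `b`), `α_True = α`,
`α_False = 1 − α`. [this work] -/
theorem real_cell_eq_sum (hah : a ≠ h) (hbh : b ≠ h) (P Q : Prop) :
    (prodBernoulli w).real ({ω | ¬ (openGraph (ω \ ↑(Finset.univ.filter fun e : Sym2 V => h ∈ e))).Reachable a b} ∩
        {ω | ω ∈ openConn a h ↔ P} ∩ {ω | ω ∈ openConn b h ↔ Q}) =
      ∑ x : BondConfig V, (prodBernoulli w).real {ω | ω \ ↑(Finset.univ.filter fun e : Sym2 V => h ∈ e) = x} *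
        ((if (openGraph x).Reachable a b then 0 else 1) *
          (if P then (prodBernoulli w).real {ω | ∃ v ∈ Finset.univ.filter (fun v => v ≠ h ∧ (openGraph x).Reachable a v), s(h, v) ∈ ω}
            else 1 - (prodBernoulli w).real {ω | ∃ v ∈ Finset.univ.filter (fun v => v ≠ h ∧ (openGraph x).Reachable a v), s(h, v) ∈ ω}) *
          (if Q then (prodBernoulli w).real {ω | ∃ v ∈ Finset.univ.filter (fun v => v ≠ h ∧ (openGraph x).Reachable b v), s(h, v) ∈ ω}
            else 1 - (prodBernoulli w).real {ω | ∃ v ∈ Finset.univ.filter (fun v => v ≠ h ∧ (openGraph x).Reachable b v), s(h, v) ∈ ω})) := by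
  rw [real_eq_sum_offStar w h]
  refine Finset.sum_congr rfl fun x _ => ?_
  set H : Finset (Sym2 V) := Finset.univ.filter fun e : Sym2 V => h ∈ e with hH
  set Sa : Finset V := Finset.univ.filter (fun v => v ≠ h ∧ (openGraph x).Reachable a v) with hSa
  set Sb : Finset V := Finset.univ.filter (fun v => v ≠ h ∧ (openGraph x).Reachable b v) with hSb
  set HA : Set (BondConfig V) := {ω | ∃ v ∈ Sa, s(h, v) ∈ ω} with hHA
  set HB : Set (BondConfig V) := {ω | ∃ v ∈ Sb, s(h, v) ∈ ω} with hHB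
  have hAeq : (openConn a h : Set (BondConfig V)) = {ω | ∃ v, v ≠ h ∧ s(h, v) ∈ ω ∧ (openGraph (ω \ ↑H)).Reachable a v} :=
    openConn_h_eq_hit a h hah
  have hBeq : (openConn b h : Set (BondConfig V)) = {ω | ∃ v, v ≠ h ∧ s(h, v) ∈ ω ∧ (openGraph (ω \ ↑H)).Reachable b v} :=
    openConn_h_eq_hit b h hbh
  by_cases hR : (openGraph x).Reachable a b
  · -- the cell is empty over this `x`
    rw [if_pos hR]
    have hempty : {ω : BondConfig V | ω \ ↑H = x} ∩ ({ω | ¬ (openGraph (ω \ ↑H)).Reachable a b} ∩ {ω | ω ∈ openConn a h ↔ P} ∩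
        {ω | ω ∈ openConn b h ↔ Q}) = ∅ := by
      ext ω
      simp only [mem_inter_iff, mem_setOf_eq, mem_empty_iff_false, iff_false]
      rintro ⟨hx, ⟨hn, -⟩, -⟩
      exact hn (hx ▸ hR)
    rw [hempty, measureReal_empty]; ring
  · rw [if_neg hR]
    -- over this `x` the literals are literals of the two hit events
    have hlitA : {ω : BondConfig V | ω \ ↑H = x} ∩ {ω | ω ∈ openConn a h ↔ P} = {ω | ω \ ↑H = x} ∩ {ω | ω ∈ HA ↔ P} := by
      ext ω
      simp only [mem_inter_iff, mem_setOf_eq]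
      constructor
      · rintro ⟨hx, hP⟩
        refine ⟨hx, ?_⟩
        rw [← hP, hAeq]
        simp only [mem_setOf_eq, hHA, hSa, Finset.mem_filter, Finset.mem_univ, true_and]
        constructor
        · rintro ⟨v, ⟨hvh, hr⟩, hv⟩; exact ⟨v, hvh, hv, hx ▸ hr⟩
        · rintro ⟨v, hvh, hv, hr⟩; exact ⟨v, ⟨hvh, hx ▸ hr⟩, hv⟩
      · rintro ⟨hx, hP⟩
        refine ⟨hx, ?_⟩
        rw [← hP, hAeq]
        simp only [mem_setOf_eq, hHA, hSa, Finset.mem_filter, Finset.mem_univ, true_and]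
        constructor
        · rintro ⟨v, hvh, hv, hr⟩; exact ⟨v, ⟨hvh, hx ▸ hr⟩, hv⟩
        · rintro ⟨v, ⟨hvh, hr⟩, hv⟩; exact ⟨v, hvh, hv, hx ▸ hr⟩
    have hlitB : {ω : BondConfig V | ω \ ↑H = x} ∩ {ω | ω ∈ openConn b h ↔ Q} = {ω | ω \ ↑H = x} ∩ {ω | ω ∈ HB ↔ Q} := by
      ext ω
      simp only [mem_inter_iff, mem_setOf_eq]
      constructor
      · rintro ⟨hx, hQ⟩
        refine ⟨hx, ?_⟩
        rw [← hQ, hBeq]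
        simp only [mem_setOf_eq, hHB, hSb, Finset.mem_filter, Finset.mem_univ, true_and]
        constructor
        · rintro ⟨v, ⟨hvh, hr⟩, hv⟩; exact ⟨v, hvh, hv, hx ▸ hr⟩
        · rintro ⟨v, hvh, hv, hr⟩; exact ⟨v, ⟨hvh, hx ▸ hr⟩, hv⟩
      · rintro ⟨hx, hQ⟩
        refine ⟨hx, ?_⟩
        rw [← hQ, hBeq]
        simp only [mem_setOf_eq, hHB, hSb, Finset.mem_filter, Finset.mem_univ, true_and]
        constructor
        · rintro ⟨v, hvh, hv, hr⟩; exact ⟨v, ⟨hvh, hx ▸ hr⟩, hv⟩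
        · rintro ⟨v, ⟨hvh, hr⟩, hv⟩; exact ⟨v, hvh, hv, hx ▸ hr⟩
    have hset : {ω : BondConfig V | ω \ ↑H = x} ∩ ({ω | ¬ (openGraph (ω \ ↑H)).Reachable a b} ∩ {ω | ω ∈ openConn a h ↔ P} ∩
        {ω | ω ∈ openConn b h ↔ Q}) = {ω | ω \ ↑H = x} ∩ ({ω | ω ∈ HA ↔ P} ∩ {ω | ω ∈ HB ↔ Q}) := by
      ext ω
      constructor
      · rintro ⟨hx, ⟨-, hP⟩, hQ⟩
        exact ⟨hx, (show ω ∈ {ω : BondConfig V | ω \ ↑H = x} ∩ {ω | ω ∈ HA ↔ P} by rw [← hlitA]; exact ⟨hx, hP⟩).2,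
          (show ω ∈ {ω : BondConfig V | ω \ ↑H = x} ∩ {ω | ω ∈ HB ↔ Q} by rw [← hlitB]; exact ⟨hx, hQ⟩).2⟩
      · rintro ⟨hx, hP, hQ⟩
        refine ⟨hx, ⟨?_, (show ω ∈ {ω : BondConfig V | ω \ ↑H = x} ∩ {ω | ω ∈ openConn a h ↔ P} by rw [hlitA]; exact ⟨hx, hP⟩).2⟩,
          (show ω ∈ {ω : BondConfig V | ω \ ↑H = x} ∩ {ω | ω ∈ openConn b h ↔ Q} by rw [hlitB]; exact ⟨hx, hQ⟩).2⟩
        simp only [mem_setOf_eq] at hx ⊢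
        rw [hx]; exact hR
    -- disjointness of the two clusters off the star
    have hdisj : Disjoint Sa Sb := by
      rw [Finset.disjoint_left]
      intro v hva hvb
      simp only [hSa, hSb, Finset.mem_filter, Finset.mem_univ, true_and] at hva hvb
      exact hR (hva.2.trans hvb.2.symm)
    have hhS : h ∉ Sa := by simp [hSa]
    have hA' : {ω : BondConfig V | ω ∈ HA ↔ P} = HA ∨ {ω : BondConfig V | ω ∈ HA ↔ P} = HAᶜ := by
      by_cases hP : P
      · left; ext ω; simp [hP]
      · right; ext ω; simp [hP]
    have hB' : {ω : BondConfig V | ω ∈ HB ↔ Q} = HB ∨ {ω : BondConfig V | ω ∈ HB ↔ Q} = HBᶜ := by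
      by_cases hQ : Q
      · left; ext ω; simp [hQ]
      · right; ext ω; simp [hQ]
    rw [hset, real_offStar_inter_hits w h x hdisj hhS _ _ hA' hB']
    have hPA : (prodBernoulli w).real {ω : BondConfig V | ω ∈ HA ↔ P} = if P then (prodBernoulli w).real HA else 1 - (prodBernoulli w).real HA := by
      by_cases hP : P
      · rw [if_pos hP]; congr 1; ext ω; simp [hP]
      · rw [if_neg hP, ← probReal_compl_eq_one_sub MeasurableSet.of_discrete]; congr 1; ext ω; simp [hP]
    have hQB : (prodBernoulli w).real {ω : BondConfig V | ω ∈ HB ↔ Q} = if Q then (prodBernoulli w).real HB else 1 - (prodBernoulli w).real HB := by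
      by_cases hQ : Q
      · rw [if_pos hQ]; congr 1; ext ω; simp [hQ]
      · rw [if_neg hQ, ← probReal_compl_eq_one_sub MeasurableSet.of_discrete]; congr 1; ext ω; simp [hQ]
    rw [hPA, hQB]; ring

end Sums


/-! ## The percolation with the star of `h` closed, and van den Berg–Häggström–Kahn -/

section BHK

variable (w : Sym2 V → unitInterval) (a b h : V)

omit [DecidableEq V] in
/-- Set integrals on the finite configuration space are finite sums over singletons. [folklore] -/
theorem setIntegral_eq_sum_singleton (μ : Measure (BondConfig V)) [IsFiniteMeasure μ] (D : Set (BondConfig V))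
    (g : BondConfig V → ℝ) :
    ∫ ω in D, g ω ∂μ = ∑ x : BondConfig V, D.indicator (fun x => μ.real {x}) x * g x := by
  rw [MeasureTheory.integral_fintype]
  · refine Finset.sum_congr rfl fun x _ => ?_
    rw [smul_eq_mul]
    try rw [← measureReal_def]
    rw [measureReal_restrict_apply MeasurableSet.of_discrete]
    by_cases hx : x ∈ D
    · rw [Set.indicator_of_mem hx, Set.inter_eq_self_of_subset_left (Set.singleton_subset_iff.2 hx)]
    · rw [Set.indicator_of_notMem hx, Set.singleton_inter_eq_empty.2 hx, measureReal_empty]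
  · exact Integrable.of_finite

/-- **The law of the off-star configuration**: with `w₀` = `w` with the pairs at `h` closed,
`P_{w₀}({x}) = P_w(ω ∖ H = x)` for every `x`. [this work] -/
theorem real_singleton_star_closed (x : BondConfig V) :
    (prodBernoulli (fun e : Sym2 V => if h ∈ e then (0 : unitInterval) else w e)).real {x} =
      (prodBernoulli w).real {ω | ω \ ↑(Finset.univ.filter fun e : Sym2 V => h ∈ e) = x} := by
  set H : Finset (Sym2 V) := Finset.univ.filter fun e : Sym2 V => h ∈ e with hH
  set w₀ : Sym2 V → unitInterval := fun e => if h ∈ e then (0 : unitInterval) else w e with hw₀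
  by_cases hx : ∃ e ∈ x, h ∈ e
  · obtain ⟨e, hex, hhe⟩ := hx
    have hempty : {ω : BondConfig V | ω \ ↑H = x} = ∅ := by
      ext ω
      simp only [mem_setOf_eq, mem_empty_iff_false, iff_false]
      intro hω
      have : e ∈ ω \ ↑H := hω ▸ hex
      exact ((mem_sdiff_star_iff ω h e).1 this).2 hhe
    rw [hempty, measureReal_empty]
    refine le_antisymm ?_ measureReal_nonneg
    calc (prodBernoulli w₀).real {x} ≤ (prodBernoulli w₀).real {ω | e ∈ ω} :=
          measureReal_mono (fun ω hω => by rw [mem_singleton_iff.1 hω]; exact hex)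
      _ = (w₀ e : ℝ) := prodBernoulli_real_setOf_mem w₀ e
      _ = 0 := by simp [hw₀, hhe]
  · push Not at hx
    -- the event is determined by the pairs off the star, where `w` and `w₀` agree
    have h1 : (prodBernoulli w).real {ω : BondConfig V | ω \ ↑H = x} = (prodBernoulli w₀).real {ω : BondConfig V | ω \ ↑H = x} :=
      prodBernoulli_real_eq_of_determinedBy w w₀ (F := (↑(Finset.univ \ H) : Set (Sym2 V)))
        (fun e he => by
          have he' : h ∉ e := by simpa [hH] using he
          simp [hw₀, he'])
        (determinedBy_offStar_eq h x) MeasurableSet.of_discrete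
    rw [h1]
    -- under `w₀` the star of `h` is a.s. closed
    have hnull : (prodBernoulli w₀).real {ω : BondConfig V | ∃ e ∈ H, e ∈ ω} = 0 := by
      refine le_antisymm ((prodBernoulli_real_exists_mem_le_sum w₀ H).trans (le_of_eq ?_)) measureReal_nonneg
      refine Finset.sum_eq_zero fun e he => ?_
      have hhe : h ∈ e := by simpa [hH] using he
      simp [hw₀, hhe]
    have hxx : x \ ↑H = x := by
      ext e
      rw [mem_sdiff_star_iff]
      exact ⟨fun h' => h'.1, fun h' => ⟨h', hx e h'⟩⟩
    have hsub1 : ({x} : Set (BondConfig V)) ⊆ {ω | ω \ ↑H = x} := by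
      intro ω hω; rw [mem_singleton_iff.1 hω]; exact hxx
    have hsub2 : {ω : BondConfig V | ω \ ↑H = x} ⊆ {x} ∪ {ω | ∃ e ∈ H, e ∈ ω} := by
      intro ω hω
      by_cases hωH : ∃ e ∈ H, e ∈ ω
      · exact Or.inr hωH
      · push Not at hωH
        left
        rw [mem_singleton_iff, ← hω]
        ext e
        rw [mem_sdiff_star_iff]
        refine ⟨fun h' => ⟨h', fun hhe => hωH e (by simpa [hH] using hhe) h'⟩, fun h' => h'.1⟩
    refine le_antisymm (measureReal_mono hsub1) ?_
    calc (prodBernoulli w₀).real {ω : BondConfig V | ω \ ↑H = x}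
        ≤ (prodBernoulli w₀).real ({x} ∪ {ω | ∃ e ∈ H, e ∈ ω}) := measureReal_mono hsub2
      _ ≤ (prodBernoulli w₀).real {x} + (prodBernoulli w₀).real {ω | ∃ e ∈ H, e ∈ ω} := measureReal_union_le _ _
      _ = (prodBernoulli w₀).real {x} := by rw [hnull, add_zero]

/-- **BHK for the hitting probabilities.**  With `M(x) = P(ω∖H = x)`, `ι(x) = 1[a ↮ b in x]`, and the hitting
probabilities `α(x), β(x)` of the `x`-clusters of `a` and `b`:  `(Σ Mι)·(Σ Mιαβ) ≤ (Σ Mια)·(Σ Mιβ)` — Thm. 1.4 of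
van den Berg–Häggström–Kahn (2006) for the percolation with the star of `h` closed, applied to the increasing cluster
functions `C ↦ P(an open pair at h meets the vertex set of C)`. [cite: VandenbergHaggstromKahn2005, Thm. 1.4; this work] -/
theorem sum_hit_bhk (hab : a ≠ b) :
    (∑ x : BondConfig V, (prodBernoulli w).real {ω | ω \ ↑(Finset.univ.filter fun e : Sym2 V => h ∈ e) = x} *
        (if (openGraph x).Reachable a b then 0 else 1)) *
      (∑ x : BondConfig V, (prodBernoulli w).real {ω | ω \ ↑(Finset.univ.filter fun e : Sym2 V => h ∈ e) = x} *
        ((if (openGraph x).Reachable a b then 0 else 1) *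
          ((prodBernoulli w).real {ω | ∃ v ∈ Finset.univ.filter (fun v => v ≠ h ∧ (openGraph x).Reachable a v), s(h, v) ∈ ω} *
           (prodBernoulli w).real {ω | ∃ v ∈ Finset.univ.filter (fun v => v ≠ h ∧ (openGraph x).Reachable b v), s(h, v) ∈ ω}))) ≤
    (∑ x : BondConfig V, (prodBernoulli w).real {ω | ω \ ↑(Finset.univ.filter fun e : Sym2 V => h ∈ e) = x} *
        ((if (openGraph x).Reachable a b then 0 else 1) *
          (prodBernoulli w).real {ω | ∃ v ∈ Finset.univ.filter (fun v => v ≠ h ∧ (openGraph x).Reachable a v), s(h, v) ∈ ω})) *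
    (∑ x : BondConfig V, (prodBernoulli w).real {ω | ω \ ↑(Finset.univ.filter fun e : Sym2 V => h ∈ e) = x} *
        ((if (openGraph x).Reachable a b then 0 else 1) *
          (prodBernoulli w).real {ω | ∃ v ∈ Finset.univ.filter (fun v => v ≠ h ∧ (openGraph x).Reachable b v), s(h, v) ∈ ω})) := by
  set H : Finset (Sym2 V) := Finset.univ.filter fun e : Sym2 V => h ∈ e with hH
  set w₀ : Sym2 V → unitInterval := fun e => if h ∈ e then (0 : unitInterval) else w e with hw₀
  set μ₀ := prodBernoulli w₀ with hμ₀
  -- the two increasing cluster functions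
  set Fa : Set (Sym2 V) → ℝ := fun C =>
    (prodBernoulli w).real {ω | ∃ v ∈ Finset.univ.filter (fun v => v ≠ h ∧ (v = a ∨ ∃ e ∈ C, v ∈ e)), s(h, v) ∈ ω} with hFa
  set Fb : Set (Sym2 V) → ℝ := fun C =>
    (prodBernoulli w).real {ω | ∃ v ∈ Finset.univ.filter (fun v => v ≠ h ∧ (v = b ∨ ∃ e ∈ C, v ∈ e)), s(h, v) ∈ ω} with hFb
  have hmono : ∀ c : V, Monotone (fun C : Set (Sym2 V) =>
      (prodBernoulli w).real {ω | ∃ v ∈ Finset.univ.filter (fun v => v ≠ h ∧ (v = c ∨ ∃ e ∈ C, v ∈ e)), s(h, v) ∈ ω}) := by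
    intro c C C' hCC'
    refine measureReal_mono fun ω hω => ?_
    simp only [mem_setOf_eq, Finset.mem_filter, Finset.mem_univ, true_and] at hω ⊢
    obtain ⟨v, ⟨hvh, hv⟩, hvω⟩ := hω
    refine ⟨v, ⟨hvh, ?_⟩, hvω⟩
    rcases hv with hv | ⟨e, he, hve⟩
    · exact Or.inl hv
    · exact Or.inr ⟨e, hCC' he, hve⟩
  have hBHK := BHK2006_twoClusterConditionalAssociation.negCorrelation BHK2006_twoClusterConditionalAssociation_holds
    V w₀ a b Fa Fb (hmono a) (hmono b) hab
  -- identification of the cluster functions on configurations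
  have hid : ∀ (c : V) (x : BondConfig V),
      (prodBernoulli w).real {ω | ∃ v ∈ Finset.univ.filter (fun v => v ≠ h ∧ (v = c ∨ ∃ e ∈ openEdgeCluster x c, v ∈ e)), s(h, v) ∈ ω} =
        (prodBernoulli w).real {ω | ∃ v ∈ Finset.univ.filter (fun v => v ≠ h ∧ (openGraph x).Reachable c v), s(h, v) ∈ ω} := by
    intro c x
    have hf : Finset.univ.filter (fun v => v ≠ h ∧ (v = c ∨ ∃ e ∈ openEdgeCluster x c, v ∈ e)) =
        Finset.univ.filter (fun v => v ≠ h ∧ (openGraph x).Reachable c v) := by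
      refine Finset.filter_congr fun v _ => ?_
      rw [reachable_iff_exists_mem_openEdgeCluster x c v]
    rw [hf]
  -- singleton masses of `μ₀`
  have hsing : ∀ x : BondConfig V, {ω : BondConfig V | ¬ (openGraph ω).Reachable a b}.indicator (fun x => μ₀.real {x}) x =
      (prodBernoulli w).real {ω | ω \ ↑H = x} * (if (openGraph x).Reachable a b then 0 else 1) := by
    intro x
    by_cases hR : (openGraph x).Reachable a b
    · rw [Set.indicator_of_notMem (by simpa using hR), if_pos hR, mul_zero]
    · rw [Set.indicator_of_mem (by simpa using hR), if_neg hR, mul_one, hμ₀, real_singleton_star_closed w h x]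
  -- rewrite the four quantities of BHK as sums
  have e0 : μ₀.real {ω : BondConfig V | ¬ (openGraph ω).Reachable a b} =
      ∑ x : BondConfig V, (prodBernoulli w).real {ω | ω \ ↑H = x} * (if (openGraph x).Reachable a b then 0 else 1) := by
    have : μ₀.real {ω : BondConfig V | ¬ (openGraph ω).Reachable a b} =
        ∫ ω in {ω : BondConfig V | ¬ (openGraph ω).Reachable a b}, (1 : ℝ) ∂μ₀ := by
      rw [setIntegral_const, smul_eq_mul, mul_one, measureReal_def]
    rw [this, setIntegral_eq_sum_singleton]
    exact Finset.sum_congr rfl fun x _ => by rw [hsing x, mul_one]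
  have eab : ∫ ω in {ω : BondConfig V | ¬ (openGraph ω).Reachable a b}, Fa (openEdgeCluster ω a) * Fb (openEdgeCluster ω b) ∂μ₀ =
      ∑ x : BondConfig V, (prodBernoulli w).real {ω | ω \ ↑H = x} *
        ((if (openGraph x).Reachable a b then 0 else 1) *
          ((prodBernoulli w).real {ω | ∃ v ∈ Finset.univ.filter (fun v => v ≠ h ∧ (openGraph x).Reachable a v), s(h, v) ∈ ω} *
           (prodBernoulli w).real {ω | ∃ v ∈ Finset.univ.filter (fun v => v ≠ h ∧ (openGraph x).Reachable b v), s(h, v) ∈ ω})) := by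
    rw [setIntegral_eq_sum_singleton]
    refine Finset.sum_congr rfl fun x _ => ?_
    rw [hsing x, hFa, hFb]
    simp only []
    rw [hid a x, hid b x]; ring
  have ea : ∫ ω in {ω : BondConfig V | ¬ (openGraph ω).Reachable a b}, Fa (openEdgeCluster ω a) ∂μ₀ =
      ∑ x : BondConfig V, (prodBernoulli w).real {ω | ω \ ↑H = x} *
        ((if (openGraph x).Reachable a b then 0 else 1) *
          (prodBernoulli w).real {ω | ∃ v ∈ Finset.univ.filter (fun v => v ≠ h ∧ (openGraph x).Reachable a v), s(h, v) ∈ ω}) := by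
    rw [setIntegral_eq_sum_singleton]
    refine Finset.sum_congr rfl fun x _ => ?_
    rw [hsing x, hFa]
    simp only []
    rw [hid a x]; ring
  have eb : ∫ ω in {ω : BondConfig V | ¬ (openGraph ω).Reachable a b}, Fb (openEdgeCluster ω b) ∂μ₀ =
      ∑ x : BondConfig V, (prodBernoulli w).real {ω | ω \ ↑H = x} *
        ((if (openGraph x).Reachable a b then 0 else 1) *
          (prodBernoulli w).real {ω | ∃ v ∈ Finset.univ.filter (fun v => v ≠ h ∧ (openGraph x).Reachable b v), s(h, v) ∈ ω}) := by
    rw [setIntegral_eq_sum_singleton]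
    refine Finset.sum_congr rfl fun x _ => ?_
    rw [hsing x, hFb]
    simp only []
    rw [hid b x]; ring
  rw [e0, eab, ea, eb] at hBHK
  exact hBHK

end BHK

/-! ## The theorem -/

/-- **`P(a|b|h) · P(h pivotal for a↔b) ≤ P(ah|b) · P(bh|a)` on every finite weighted graph** (distinct `a, b, h`;
`h` pivotal = `a ↔ b` holds but fails once the pairs at `h` are removed):
`P(a↮b, a↮h, b↮h) · P(a↔b ∧ a↮b off the star of h) ≤ P(a↔h, a↮b) · P(b↔h, a↮b)`.
Corollary of van den Berg–Häggström–Kahn 2006, Thm. 1.4, after conditioning on the configuration off the star of `h`.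
[cite: VandenbergHaggstromKahn2005, Thm. 1.4; this work] -/
theorem sep_mul_pivotal_le (w : Sym2 V → unitInterval) {a b h : V} (hab : a ≠ b) (hah : a ≠ h) (hbh : b ≠ h) :
    (prodBernoulli w).real ((openConn a b)ᶜ ∩ (openConn a h)ᶜ ∩ (openConn b h)ᶜ) *
        (prodBernoulli w).real (openConn a b ∩ {ω | ¬ (openGraph (ω \ ↑(Finset.univ.filter fun e : Sym2 V => h ∈ e))).Reachable a b}) ≤
      (prodBernoulli w).real (openConn a h ∩ (openConn a b)ᶜ) * (prodBernoulli w).real (openConn b h ∩ (openConn a b)ᶜ) := by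
  obtain ⟨eq, epiv, et, eu⟩ := cells_eq a b h
  -- literal forms of the four events
  have lA1 : (openConn a h : Set (BondConfig V)) = {ω | ω ∈ openConn a h ↔ True} := by ext ω; simp
  have lA0 : ((openConn a h)ᶜ : Set (BondConfig V)) = {ω | ω ∈ openConn a h ↔ False} := by ext ω; simp
  have lB1 : (openConn b h : Set (BondConfig V)) = {ω | ω ∈ openConn b h ↔ True} := by ext ω; simp
  have lB0 : ((openConn b h)ᶜ : Set (BondConfig V)) = {ω | ω ∈ openConn b h ↔ False} := by ext ω; simp
  set N : Set (BondConfig V) := {ω | ¬ (openGraph (ω \ ↑(Finset.univ.filter fun e : Sym2 V => h ∈ e))).Reachable a b} with hN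
  set M : BondConfig V → ℝ := fun x => (prodBernoulli w).real {ω | ω \ ↑(Finset.univ.filter fun e : Sym2 V => h ∈ e) = x} with hM
  set ι : BondConfig V → ℝ := fun x => if (openGraph x).Reachable a b then 0 else 1 with hι
  set α : BondConfig V → ℝ := fun x =>
    (prodBernoulli w).real {ω | ∃ v ∈ Finset.univ.filter (fun v => v ≠ h ∧ (openGraph x).Reachable a v), s(h, v) ∈ ω} with hα
  set β : BondConfig V → ℝ := fun x =>
    (prodBernoulli w).real {ω | ∃ v ∈ Finset.univ.filter (fun v => v ≠ h ∧ (openGraph x).Reachable b v), s(h, v) ∈ ω} with hβ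
  set S0 : ℝ := ∑ x : BondConfig V, M x * ι x with hS0
  set Sa : ℝ := ∑ x : BondConfig V, M x * (ι x * α x) with hSa
  set Sb : ℝ := ∑ x : BondConfig V, M x * (ι x * β x) with hSb
  set Sab : ℝ := ∑ x : BondConfig V, M x * (ι x * (α x * β x)) with hSab
  have hbhk : S0 * Sab ≤ Sa * Sb := sum_hit_bhk w a b h hab
  -- the four cells as sums
  have hq : (prodBernoulli w).real ((openConn a b)ᶜ ∩ (openConn a h)ᶜ ∩ (openConn b h)ᶜ) = S0 - Sa - Sb + Sab := by
    rw [eq, lA0, lB0, real_cell_eq_sum w a b h hah hbh False False]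
    simp only [if_false]
    rw [hS0, hSa, hSb, hSab, ← Finset.sum_sub_distrib, ← Finset.sum_sub_distrib, ← Finset.sum_add_distrib]
    exact Finset.sum_congr rfl fun x _ => by ring
  have hpiv : (prodBernoulli w).real (openConn a b ∩ N) = Sab := by
    rw [epiv, lA1, lB1, real_cell_eq_sum w a b h hah hbh True True]
    simp only [if_true]
    exact Finset.sum_congr rfl fun x _ => by ring
  have ht : (prodBernoulli w).real (openConn a h ∩ (openConn a b)ᶜ) = Sa - Sab := by
    rw [et, lA1, lB0, real_cell_eq_sum w a b h hah hbh True False]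
    simp only [if_true, if_false]
    rw [hSa, hSab, ← Finset.sum_sub_distrib]
    exact Finset.sum_congr rfl fun x _ => by ring
  have hu : (prodBernoulli w).real (openConn b h ∩ (openConn a b)ᶜ) = Sb - Sab := by
    rw [eu, lA0, lB1, real_cell_eq_sum w a b h hah hbh False True]
    simp only [if_true, if_false]
    rw [hSb, hSab, ← Finset.sum_sub_distrib]
    exact Finset.sum_congr rfl fun x _ => by ring
  rw [hq, hpiv, ht, hu]
  nlinarith [hbhk]

end Summit.CriticalPhenomena.PercolationContinuityZ3.Theorems.ThreePointPivotalBHK
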